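import Summits.QuantumAdvantage.QuantumAdvantage.Theorems.SosSandwichTransferPBQueryCrux
import Summits.QuantumAdvantage.QuantumAdvantage.Theorems.SosSandwichPseudoBoundedAAQuerySimulable
import Summits.QuantumAdvantage.QuantumAdvantage.Theses.PromiseLift
import HarnessLib

/-!
# Route `SosSandwich` factors through route `PromiseLift`: `AA_Q ∧ X_ROG ⟹ PlThesis`

Support file for the hypothesis-type crux `RandomOracleHeurSeparation` (`X_ROG`, stmt-QuantumAdvantage-1131) of route SosSandwich,
written after the circuit→query bridge (`Theorems/SosSandwichCircuitToQuery.lean`, `…QueryPathBridge.lean`, `…TransferPBQueryCrux.lean`)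
made `AA_Q` — the Aaronson–Ambainis conjecture for quantum QUERY acceptance probabilities — the route's analytic crux.  It pins the
exact logical position of `X_ROG` by name against the route files of BOTH routes:

* `plThesis_of_aaQuery` — **`AA_Q → RandomOracleHeurSeparation → PromiseLift.PlThesis`**: granted `AA_Q`, the random-oracle
  separation thesis of SosSandwich implies the thesis X of route PromiseLift (`¬ (PromiseBQP ⊆ PromiseBPP')`, stmt-0248), by the
  transfer `QueryCrux.transfer_of_aaQuery` (AA14 Thm. 7 (iii) with its minimal hypothesis);
* `not_randomOracleHeurSeparation_of_aaQuery` — the contrapositive, i.e. the "why it might fail" mechanism recorded in the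
  docstring of `X_ROG` with `AAConjecture` weakened to `AA_Q`: `AA_Q ∧ (PromiseBQP ⊆ PromiseBPP') ⟹ ¬ X_ROG`;
* `plThesis_of_pseudoBoundedAA`, `plThesis_of_aaConjecture` — the same from the registered crux `PseudoBoundedAA` and from the
  Literature conjecture `AAConjecture` (both imply `AA_Q` in the tree);
* `promiseLanguageLift_iff_plLift` (`Iff.rfl`) and **`quantumAdvantage_of_aaQuery_via_promiseLift`** — the SosSandwich assembly
  IS `PromiseLift.closes ∘ plThesis_of_aaQuery`: SosSandwich = (AA_Q ∧ X_ROG ⟹ X of PromiseLift) + PromiseLift.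

Honest label: 3-line compositions of landed theorems; conditional on open hypotheses; nothing closes.  No new definitions.
Sources: AaronsonAmbainis2014 Thm. 7 (iii); Watrous2009 §III.2 (promise classes); Goldreich2011 §1 (the lift question).
-/

noncomputable section

-- D-0017: single-conjunct summit ⇒ the duplicate `QuantumAdvantage.QuantumAdvantage` is mandated.
set_option linter.dupNamespace false

namespace Summit.QuantumAdvantage.QuantumAdvantage.Theorems.SosSandwich.PromiseLiftLink

open Literature.Computability.Cryptography Literature.Computability.QuantumComplexity
open Summit.QuantumAdvantage.QuantumAdvantage.Theses

/-- **Granted `AA_Q`, SosSandwich's random-oracle separation implies PromiseLift's thesis X** (`¬ (PromiseBQP ⊆ PromiseBPP')`):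
were `PromiseBQP ⊆ PromiseBPP'`, the transfer `QueryCrux.transfer_of_aaQuery` would collapse `BQP^A ⊆ AvgP^A` for almost every
random oracle `A`, which `RandomOracleHeurSeparation` denies. [cite: AaronsonAmbainis2014, Thm. 7 (iii)] -/
theorem plThesis_of_aaQuery
    (hAAQ : ∃ (c : ℕ) (C : ℝ), 0 < C ∧ ∀ (N : ℕ) (Q : QQueryAlg N) (p : MvPolynomial (Fin N) ℝ) (ε : ℝ),
      1 ≤ Q.queries → (∀ x, evalBool p x = Q.acceptProb x) → 0 < ε → ε ≤ boolVariance p →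
        ∃ i : Fin N, C * (ε / Q.queries) ^ c ≤ influence i p)
    (hX : SosSandwich.RandomOracleHeurSeparation) : PromiseLift.PlThesis :=
  fun hPr => hX (QueryCrux.transfer_of_aaQuery hAAQ hPr)

/-- **The failure mechanism of `X_ROG`, with the minimal analytic hypothesis**: `AA_Q` and a promise-class collapse
`PromiseBQP ⊆ PromiseBPP'` refute `RandomOracleHeurSeparation` (the docstring of the crux records this with `AAConjecture`;
`AA_Q` is weaker: `AAConjecture ⟹ PseudoBoundedAA ⟹ AA_Q` in the tree). [cite: AaronsonAmbainis2014, Thm. 7 (iii)] -/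
theorem not_randomOracleHeurSeparation_of_aaQuery
    (hAAQ : ∃ (c : ℕ) (C : ℝ), 0 < C ∧ ∀ (N : ℕ) (Q : QQueryAlg N) (p : MvPolynomial (Fin N) ℝ) (ε : ℝ),
      1 ≤ Q.queries → (∀ x, evalBool p x = Q.acceptProb x) → 0 < ε → ε ≤ boolVariance p →
        ∃ i : Fin N, C * (ε / Q.queries) ^ c ≤ influence i p)
    (hPr : Literature.Computability.Cryptography.PromiseBQP ⊆ Literature.Computability.Complexity.PromiseBPP') :
    ¬ SosSandwich.RandomOracleHeurSeparation :=
  fun hX => hX (QueryCrux.transfer_of_aaQuery hAAQ hPr)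

/-- The registered crux `PseudoBoundedAA` (SOS class `K_T`) already gives the link (`aaQuery_of_pseudoBoundedAA`).
[cite: AaronsonAmbainis2014, Thm. 7 (iii)] -/
theorem plThesis_of_pseudoBoundedAA (hK : SosSandwich.PseudoBoundedAA) (hX : SosSandwich.RandomOracleHeurSeparation) :
    PromiseLift.PlThesis :=
  plThesis_of_aaQuery (aaQuery_of_pseudoBoundedAA hK) hX

/-- The Aaronson–Ambainis conjecture itself gives the link (`aaQuery_of_aaConjecture`): `AAConjecture ∧ X_ROG ⟹ PlThesis`.
[cite: AaronsonAmbainis2014, Conj. 6 and Thm. 7 (iii)] -/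
theorem plThesis_of_aaConjecture (hAA : AAConjecture) (hX : SosSandwich.RandomOracleHeurSeparation) : PromiseLift.PlThesis :=
  plThesis_of_aaQuery (aaQuery_of_aaConjecture hAA) hX

/-- The two routes share the promise lift verbatim: `SosSandwich.PromiseLanguageLift ↔ PromiseLift.PlLift` (`Iff.rfl`).
[cite: Goldreich2011, §1] -/
theorem promiseLanguageLift_iff_plLift : SosSandwich.PromiseLanguageLift ↔ PromiseLift.PlLift := Iff.rfl

/-- **SosSandwich factors through PromiseLift**: the summit from `AA_Q`, `X_ROG` and the lift, obtained as
`PromiseLift.closes ∘ plThesis_of_aaQuery` (same statement as `QueryCrux.quantumAdvantage_of_aaQuery`, different bookkeeping: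
the SOS route contributes exactly a conditional proof of PromiseLift's thesis X). [cite: AaronsonAmbainis2014, Thm. 7 (iii)] -/
theorem quantumAdvantage_of_aaQuery_via_promiseLift
    (hAAQ : ∃ (c : ℕ) (C : ℝ), 0 < C ∧ ∀ (N : ℕ) (Q : QQueryAlg N) (p : MvPolynomial (Fin N) ℝ) (ε : ℝ),
      1 ≤ Q.queries → (∀ x, evalBool p x = Q.acceptProb x) → 0 < ε → ε ≤ boolVariance p →
        ∃ i : Fin N, C * (ε / Q.queries) ^ c ≤ influence i p)
    (hX : SosSandwich.RandomOracleHeurSeparation) (hL : PromiseLift.PlLift) : _root_.QuantumAdvantage :=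
  PromiseLift.closes (plThesis_of_aaQuery hAAQ hX) hL

end Summit.QuantumAdvantage.QuantumAdvantage.Theorems.SosSandwich.PromiseLiftLink

end
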